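import Summits.CriticalPhenomena.PercolationContinuityZ3.Theorems.PercNearOneGluingNoHeavyLowerTailMaxPioneerChargingStar
import Summits.CriticalPhenomena.PercolationContinuityZ3.Theorems.PercNearOneGluingNoHeavyLowerTailFatMinorityCounting
import HarnessLib

/-!
# `NoHeavyLowerTail` (stmt-CriticalPhenomena-4575), line fat-minority-linear — the STAR-ATTACHED
# observer class of the stub `stub_fatMinorityLinear` (constant 2, `d₀ = 0`)

An observer `o ∉ A` is *star-attached* if every pair at `o` of positive weight joins `o` to a relay
(`w s(o, v) = 0` for `v ∉ A`, `v ≠ o`).  For such observers lead c3's first-hit charging theorem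
`firstHitChargingStar` (Kozma–Nitzan's Lemma 3(ii) exchange + the Star Lemma) reads

  `P(o ↔ A, o ↮ b) ≤ Σ_{a ∈ A} (hit weight of a) · P(a ↮ b)`        (`b ∈ A`),

and the hit weights (`a`'s coin open, every coin of higher priority closed) sum to
`1 − ∏_a (1 − w s(o,a)) ≤ 1` (`maxPC_hitWeight_sum`).  Hence (this file, sorry-free):

* `starAttached_bad_le` — LINEAR GLUING WITH CONSTANT 1 for star-attached observers:
  `P(o ↔ A, o ↮ b) ≤ max_{a ∈ A} P(a ↮ b)` for `b ∈ A`, i.e. `P(o ↮ b) ≤ P(o ↮ A) + η`.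
* `fatMinority_starAttached` — **the stub on the star-attached class, constant 2, no `d₀`:**
  `P(d₀ < N ∧ 2N ≤ |A|) ≤ P(2N ≤ |A|) ≤ 2 · (P(o ↮ A) + η)` (Markov for the missed count,
  `minority_le_two_mul`).

So the registered stub holds on (i) bounded relay sets (`fatMinority_pairCount`), (ii) the
no-majority class (`minority_noMajority_le`), (iii) star-attached observers (here); its residual is
the majority-miss event of a NON-star observer through a moving entrance relay
(`…FatMinorityMajoritySplit`, `…FatMinorityFixedRelay`).  Credits: `firstHitChargingStar`,
`maxPC_hitWeight_sum` (lead c3); this file is bookkeeping.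
-/

noncomputable section

namespace Summit.CriticalPhenomena.PercolationContinuityZ3.Theorems

open MeasureTheory Set Literature.Probability.LatticeModels Literature.Probability.Percolation
open scoped Classical BigOperators

/-- **Linear gluing with constant 1 for star-attached observers.** If every positive-weight pair at
`o ∉ A` joins `o` to a relay, `b ∈ A`, and `P(a ↮ b) ≤ η` for all `a ∈ A`, then
`P(o ↔ A, o ↮ b) ≤ η`.  From `firstHitChargingStar` (the bad event charged to the relays with
first-hit weights) and `maxPC_hitWeight_sum` (the weights sum to `1 − ∏ (1 − w) ≤ 1`).
[cite: KozmaNitzan2024, Lemma 3(ii) (p. 6)] -/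
theorem starAttached_bad_le (n : ℕ) (w : Sym2 (Fin n) → unitInterval) (A : Finset (Fin n))
    (o b : Fin n) (η : ℝ) (hbA : b ∈ A) (hoA : o ∉ A)
    (hstar : ∀ v : Fin n, v ∉ A → v ≠ o → w s(o, v) = 0)
    (hη : ∀ a ∈ A, (prodBernoulli w).real (openConn a b : Set (BondConfig (Fin n)))ᶜ ≤ η) :
    (prodBernoulli w).real ((⋃ a ∈ A, (openConn o a : Set (BondConfig (Fin n)))) ∩
        (openConn o b : Set (BondConfig (Fin n)))ᶜ) ≤ η := by
  have h := firstHitChargingStar n w A o b hbA hoA hstar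
  have hη0 : 0 ≤ η := le_trans measureReal_nonneg (hη b hbA)
  -- coins and the lexicographic priority key
  have hq0 : ∀ a : Fin n, 0 ≤ ((w s(o, a) : unitInterval) : ℝ) := fun a => (w s(o, a)).2.1
  have hq1 : ∀ a : Fin n, ((w s(o, a) : unitInterval) : ℝ) ≤ 1 := fun a => (w s(o, a)).2.2
  let d : Fin n → ℝ := fun a =>
    (prodBernoulli w).real (openConnIn (({o} : Set (Fin n))ᶜ) a b : Set (BondConfig (Fin n)))ᶜ
  let σ : Fin n → Lex (ℝ × Fin n) := fun a => toLex (d a, a)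
  have hσ : Set.InjOn σ (↑A : Set (Fin n)) := by
    intro a _ a' _ hEq
    exact congrArg Prod.snd (toLex.injective hEq)
  have hfilter : ∀ a : Fin n,
      A.filter (fun a' =>
        (prodBernoulli w).real (openConnIn (({o} : Set (Fin n))ᶜ) a b : Set (BondConfig (Fin n)))ᶜ <
          (prodBernoulli w).real (openConnIn (({o} : Set (Fin n))ᶜ) a' b : Set (BondConfig (Fin n)))ᶜ ∨
        ((prodBernoulli w).real (openConnIn (({o} : Set (Fin n))ᶜ) a b : Set (BondConfig (Fin n)))ᶜ =
          (prodBernoulli w).real (openConnIn (({o} : Set (Fin n))ᶜ) a' b : Set (BondConfig (Fin n)))ᶜ ∧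
          a < a')) =
      A.filter (fun a' => σ a < σ a') := by
    intro a
    refine Finset.filter_congr fun a' _ => ?_
    change d a < d a' ∨ (d a = d a' ∧ a < a') ↔ toLex (d a, a) < toLex (d a', a')
    rw [Prod.Lex.toLex_lt_toLex]
  have hsum : ∑ a ∈ A, ((w s(o, a) : unitInterval) : ℝ) *
      ∏ a' ∈ A.filter (fun a' => σ a < σ a'), (1 - ((w s(o, a') : unitInterval) : ℝ)) =
      1 - ∏ a ∈ A, (1 - ((w s(o, a) : unitInterval) : ℝ)) :=
    maxPC_hitWeight_sum σ (fun a => ((w s(o, a) : unitInterval) : ℝ)) A hσ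
  have hprod : 0 ≤ ∏ a ∈ A, (1 - ((w s(o, a) : unitInterval) : ℝ)) :=
    Finset.prod_nonneg fun a _ => sub_nonneg.2 (hq1 a)
  have hW0 : ∀ a : Fin n, 0 ≤ ((w s(o, a) : unitInterval) : ℝ) *
      ∏ a' ∈ A.filter (fun a' => σ a < σ a'), (1 - ((w s(o, a') : unitInterval) : ℝ)) :=
    fun a => mul_nonneg (hq0 a) (Finset.prod_nonneg fun a' _ => sub_nonneg.2 (hq1 a'))
  refine h.trans ?_
  calc ∑ a ∈ A, (((w s(o, a) : unitInterval) : ℝ) *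
          ∏ a' ∈ A.filter (fun a' =>
            (prodBernoulli w).real (openConnIn (({o} : Set (Fin n))ᶜ) a b : Set (BondConfig (Fin n)))ᶜ <
              (prodBernoulli w).real (openConnIn (({o} : Set (Fin n))ᶜ) a' b : Set (BondConfig (Fin n)))ᶜ ∨
            ((prodBernoulli w).real (openConnIn (({o} : Set (Fin n))ᶜ) a b : Set (BondConfig (Fin n)))ᶜ =
              (prodBernoulli w).real (openConnIn (({o} : Set (Fin n))ᶜ) a' b : Set (BondConfig (Fin n)))ᶜ ∧
              a < a')), (1 - ((w s(o, a') : unitInterval) : ℝ))) *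
          (prodBernoulli w).real (openConn a b : Set (BondConfig (Fin n)))ᶜ
      = ∑ a ∈ A, (((w s(o, a) : unitInterval) : ℝ) *
          ∏ a' ∈ A.filter (fun a' => σ a < σ a'), (1 - ((w s(o, a') : unitInterval) : ℝ))) *
          (prodBernoulli w).real (openConn a b : Set (BondConfig (Fin n)))ᶜ := by
        refine Finset.sum_congr rfl fun a _ => ?_
        rw [hfilter a]
    _ ≤ ∑ a ∈ A, (((w s(o, a) : unitInterval) : ℝ) *
          ∏ a' ∈ A.filter (fun a' => σ a < σ a'), (1 - ((w s(o, a') : unitInterval) : ℝ))) * η :=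
        Finset.sum_le_sum fun a ha => mul_le_mul_of_nonneg_left (hη a ha) (hW0 a)
    _ = (1 - ∏ a ∈ A, (1 - ((w s(o, a) : unitInterval) : ℝ))) * η := by
        rw [← Finset.sum_mul, hsum]
    _ ≤ η := by nlinarith

/-- **Linear gluing, additive form, for star-attached observers**: `P(o ↮ b) ≤ P(o ↮ A) + η` for
`b ∈ A`. [cite: KozmaNitzan2024, Lemma 3(ii) (p. 6)] -/
theorem starAttached_notConn_le (n : ℕ) (w : Sym2 (Fin n) → unitInterval) (A : Finset (Fin n))
    (o b : Fin n) (η : ℝ) (hbA : b ∈ A) (hoA : o ∉ A)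
    (hstar : ∀ v : Fin n, v ∉ A → v ≠ o → w s(o, v) = 0)
    (hη : ∀ a ∈ A, (prodBernoulli w).real (openConn a b : Set (BondConfig (Fin n)))ᶜ ≤ η) :
    (prodBernoulli w).real (openConn o b : Set (BondConfig (Fin n)))ᶜ ≤
      (prodBernoulli w).real (⋃ a ∈ A, (openConn o a : Set (BondConfig (Fin n))))ᶜ + η := by
  have hcov : (openConn o b : Set (BondConfig (Fin n)))ᶜ ⊆
      (⋃ a ∈ A, (openConn o a : Set (BondConfig (Fin n))))ᶜ ∪
        ((⋃ a ∈ A, (openConn o a : Set (BondConfig (Fin n)))) ∩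
          (openConn o b : Set (BondConfig (Fin n)))ᶜ) := by
    intro ω hω
    by_cases hU : ω ∈ ⋃ a ∈ A, (openConn o a : Set (BondConfig (Fin n)))
    · exact Or.inr ⟨hU, hω⟩
    · exact Or.inl hU
  calc (prodBernoulli w).real (openConn o b : Set (BondConfig (Fin n)))ᶜ
      ≤ (prodBernoulli w).real ((⋃ a ∈ A, (openConn o a : Set (BondConfig (Fin n))))ᶜ ∪
          ((⋃ a ∈ A, (openConn o a : Set (BondConfig (Fin n)))) ∩
            (openConn o b : Set (BondConfig (Fin n)))ᶜ)) :=
        measureReal_mono hcov (measure_ne_top _ _)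
    _ ≤ (prodBernoulli w).real (⋃ a ∈ A, (openConn o a : Set (BondConfig (Fin n))))ᶜ +
          (prodBernoulli w).real ((⋃ a ∈ A, (openConn o a : Set (BondConfig (Fin n)))) ∩
            (openConn o b : Set (BondConfig (Fin n)))ᶜ) := measureReal_union_le _ _
    _ ≤ _ := by
        have := starAttached_bad_le n w A o b η hbA hoA hstar hη
        linarith

/-- **The fat-minority stub on the star-attached class (constant 2, any `d₀`).**  If `o ∉ A` is
star-attached and `P(a ↮ a') ≤ η` for all `a, a' ∈ A`, then
`P(d₀ < N ∧ 2N ≤ |A|) ≤ 2 · (P(o ↮ A) + η)`: every relay is missed with probability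
`≤ P(o ↮ A) + η` (`starAttached_notConn_le`), then Markov for the missed count
(`minority_le_two_mul`). [cite: KozmaNitzan2024, Lemma 3(ii) (p. 6)] -/
theorem fatMinority_starAttached (n : ℕ) (w : Sym2 (Fin n) → unitInterval) (A : Finset (Fin n))
    (o : Fin n) (d₀ : ℕ) (η : ℝ) (hη : 0 ≤ η) (hoA : o ∉ A)
    (hstar : ∀ v : Fin n, v ∉ A → v ≠ o → w s(o, v) = 0)
    (hpair : ∀ a ∈ A, ∀ a' ∈ A, (prodBernoulli w).real (openConn a a' : Set (BondConfig (Fin n)))ᶜ ≤ η) :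
    (prodBernoulli w).real {ω : BondConfig (Fin n) |
        d₀ < (A.filter fun a => ω ∈ openConn o a).card ∧
          2 * (A.filter fun a => ω ∈ openConn o a).card ≤ A.card} ≤
      2 * ((prodBernoulli w).real (⋃ a ∈ A, (openConn o a : Set (BondConfig (Fin n))))ᶜ + η) := by
  rcases A.eq_empty_or_nonempty with hAe | hAne
  · subst hAe
    have hempty : {ω : BondConfig (Fin n) |
        d₀ < ((∅ : Finset (Fin n)).filter fun a => ω ∈ openConn o a).card ∧
          2 * ((∅ : Finset (Fin n)).filter fun a => ω ∈ openConn o a).card ≤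
            (∅ : Finset (Fin n)).card} = ∅ := by
      ext ω
      simp
    rw [hempty, measureReal_empty]
    exact mul_nonneg (by norm_num) (add_nonneg measureReal_nonneg hη)
  · obtain ⟨a₁, ha₁⟩ := hAne
    have hM : ∀ a ∈ A, (prodBernoulli w).real (openConn o a : Set (BondConfig (Fin n)))ᶜ ≤
        (prodBernoulli w).real (⋃ a ∈ A, (openConn o a : Set (BondConfig (Fin n))))ᶜ + η :=
      fun a ha => starAttached_notConn_le n w A o a η ha hoA hstar (fun a' ha' => hpair a' ha' a ha)
    exact (fatMinority_le_minority w A o d₀).trans (minority_le_two_mul w A o ⟨a₁, ha₁⟩ _ hM)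

end Summit.CriticalPhenomena.PercolationContinuityZ3.Theorems

end
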